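import Summits.QuantumFields.YangMills.Theorems.UnitScaleTiltProp7PTermLocalGaugeKnit
import Summits.QuantumFields.YangMills.Theorems.UnitScaleTiltProp7IMSSumOfSquaresLocalisation
import HarnessLib

/-!
# Route `UnitScaleTilt`, crux K1 «MinimiserStabilityRegPr» (stmt-QuantumFields-19200), EX row `hGF` (curved member) — **(L6) SLOT `hK₂` OF THE KNIT ✓`Prop7LODAssembly`, IN HYPOTHESIS
# FORM: `[R∘D*, χ] = R∘[D*,χ] + [R,χ′]∘D*` knitted into the binder shape `κ₂²‖A‖² + μ₂·q_U(A)`** (★p1 g24 00:40:07Z slot map: `hK₂` ← w5)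

Cell `ym3-torus` (HUMAN RULING D-0037, rung R3 — NOT d = 4, NOT a mass gap, NOT Clay).  Width seat `ym-ust-19200-w5` (gen 13); chair ★`ym-ust-19200-p1` g24.  THEOREMS ONLY (0 `def`, 0 `sorry`);
`--supports stmt-QuantumFields-19200 --as helper`.  HONEST LABEL (№33 (6)): LOD-line knit of ONE slot with its member rows as HYPOTHESES; nothing of (3.49), `h349`, `hGF`, EX, the crux proved.

THE POINT.  The knit's slot is `hK₂ : Σ_j ‖T₂(M_jA) − N₂,j(T₂A)‖² ≤ κ₂²‖A‖² + μ₂·q_U(A)` with `T₂ = R ∘ D*_{U₀}`, `R = projR(covLapSite U₀)Q_U` (a contraction).  Since `R` is additive,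
`R(D*(M_jA)) − N_j(R(D*A)) = R([D*,χ]_j A) + [R, N_j](D*A)`, so two FAMILY rows suffice: (K2a) the `D*`-commutator family row `Σ_j ‖D*(M_jA) − N_j(D*A)‖² ≤ κ_D²‖A‖²` (pen (L6-χ),
fine-smooth cut-offs, `κ_D² ∝ ℓ_f²η⁻²` K-free) and (K2b) the `R`-commutator family row `Σ_j ‖R(N_j y) − N_j(R y)‖² ≤ κ_P²‖y‖²` (= the `P = 1 − R` commutator; abstract core
✓`Prop7IMSFirstOrderBlockCommutator` fed by the block bounds of `P`'s kernel and ✓`Prop7CoarseLipschitzTdist`); the naked `‖D*A‖²` that (K2b) produces is paid in the RELATIVE currency by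
(K2d) `‖D*A‖² ≤ ‖R(D*A)‖² + c_R‖A‖²` (★p1 ✓`Prop7RTermFloor.normSq_adjoint_le_normSq_projR_add`) and (K2e) the curvature floor `−ν‖A‖² ≤ re⟪A, Δ^η_U A⟫` (✓p750892-class), giving
`hK₂` with `κ₂² = 2κ_D² + 2κ_P²(c_R + ν)`, `μ₂ = 2κ_P²`.

WHAT IS PROVED (ns `…Theorems.Prop7LODSlotK2`).
* §1 (abstract, seminormed groups) ★★ `sum_normSq_compComm_le` (`Σ_j ‖R(T(M_jA)) − N_j(R(TA))‖² ≤ 2κ_D²‖A‖² + 2κ_P²‖TA‖²` for a contraction `R`),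
  ★★ `sum_normSq_compComm_le_rel` (the relative currency: `≤ (2κ_D² + 2κ_P²(c_R + ν))‖A‖² + 2κ_P²·q A` under `‖TA‖² ≤ ‖R(TA)‖² + c_R‖A‖²`, `‖R(TA)‖² ≤ q A + ν‖A‖²`).
* §2 (member) ★★★ `hK2_of_rows` — the slot `hK₂` of ✓`curvedTarget_of_LOD_topMean` at `T₂ := projR(covLapSite U₀)Q_U ∘ DstarL2 U₀` from the rows (K2a)(K2b)(K2d)(K2e); the contraction row of `R`
  is DISCHARGED (✓`Prop7PTermLocalGaugeKnit.normSq_sub_projR_eq`).  (The knit takes `κ₂` through `κ₂ ^ 2`: feed `κ₂ := √(2κ_D² + 2κ_P²(c_R + ν))`, `Real.sq_sqrt`.)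
WHY IT MIGHT FAIL: nothing here; the member rows (K2a)(K2b) must be K-uniform (`κ_D², κ_P² = O(L^{−2s})`-class) — pens (L6-χ) ∕ routeR-w2 + the abstract cores.

References: T. Bałaban, CMP **99** (1985) 389–434 [Balaban1985BackgroundPropagators] ((3.21) p.394, (3.49) p.399, Thm 3.11 p.416).
-/

set_option autoImplicit false

noncomputable section

open scoped InnerProductSpace ComplexConjugate BigOperators

namespace Summit.QuantumFields.YangMills.Theorems.Prop7LODSlotK2

open Literature.MathematicalPhysics.QuantumFieldTheory.Balaban1983to89
open Literature.MathematicalPhysics.QuantumFieldTheory.Balaban1983to89.T3ContinuumYM3Torus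
open T4Continuum BlockAveraging
open B9Eq311L2Pairing (WL2)
open B11Eq103H1Complex (SiteL2K BondL2K projR)
open Summit.QuantumFields.YangMills.Theorems.Prop7SectET3Transport (periodsT3)
open Summit.QuantumFields.YangMills.Theorems.Prop7SectET3HilbertLetters (W₂ DstarL2 covLapSite)
open Summit.QuantumFields.YangMills.Theorems.Prop7SectET3WilsonHessian (DeltaEta)
open Summit.QuantumFields.YangMills.Theorems.Prop7SectET3CurvedPropagators (Qk)
open Summit.QuantumFields.YangMills.Theorems.Prop7IMSSumOfSquaresLocalisation (normSq_add_le_weighted)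
open Summit.QuantumFields.YangMills.Theorems.Prop7PTermLocalGaugeKnit (normSq_sub_projR_eq)

/-! ## §1 The abstract slot -/

section Abstract

variable {J : Type*} [Fintype J] {E S : Type*} [SeminormedAddCommGroup E] [SeminormedAddCommGroup S] {𝕜 : Type*} [Ring 𝕜] [Module 𝕜 S]

/-- ★★ **COMPOSITE COMMUTATOR, SQUARED AND SUMMED**: `R` an additive contraction (`‖Ry‖² ≤ ‖y‖²`), family rows `Σ_j ‖T(M_jA) − N_j(TA)‖² ≤ κ_D²‖A‖²` and `Σ_j ‖R(N_jy) − N_j(Ry)‖² ≤ κ_P²‖y‖²`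
⟹ `Σ_j ‖R(T(M_jA)) − N_j(R(TA))‖² ≤ 2κ_D²‖A‖² + 2κ_P²‖TA‖²`. [cite: Balaban1985BackgroundPropagators, Thm 3.11 p.416] -/
theorem sum_normSq_compComm_le (T : E → S) (R : S →ₗ[𝕜] S) (M : J → E → E) (N : J → S → S) {κD κP : ℝ}
    (hR : ∀ y, ‖R y‖ ^ 2 ≤ ‖y‖ ^ 2)
    (hKD : ∀ A, ∑ j, ‖T (M j A) - N j (T A)‖ ^ 2 ≤ κD ^ 2 * ‖A‖ ^ 2)
    (hKP : ∀ y, ∑ j, ‖R (N j y) - N j (R y)‖ ^ 2 ≤ κP ^ 2 * ‖y‖ ^ 2) (A : E) :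
    ∑ j, ‖R (T (M j A)) - N j (R (T A))‖ ^ 2 ≤ 2 * κD ^ 2 * ‖A‖ ^ 2 + 2 * κP ^ 2 * ‖T A‖ ^ 2 := by
  have e : ∀ j, R (T (M j A)) - N j (R (T A)) = R (T (M j A) - N j (T A)) + (R (N j (T A)) - N j (R (T A))) := fun j => by
    rw [map_sub]; abel
  have h1 : ∀ j, ‖R (T (M j A)) - N j (R (T A))‖ ^ 2 ≤ 2 * ‖T (M j A) - N j (T A)‖ ^ 2 + 2 * ‖R (N j (T A)) - N j (R (T A))‖ ^ 2 := by
    intro j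
    rw [e j]
    have h := normSq_add_le_weighted (R (T (M j A) - N j (T A))) (R (N j (T A)) - N j (R (T A))) one_pos
    have hRu := hR (T (M j A) - N j (T A))
    rw [inv_one] at h
    linarith
  calc ∑ j, ‖R (T (M j A)) - N j (R (T A))‖ ^ 2
      ≤ ∑ j, (2 * ‖T (M j A) - N j (T A)‖ ^ 2 + 2 * ‖R (N j (T A)) - N j (R (T A))‖ ^ 2) := Finset.sum_le_sum fun j _ => h1 j
    _ = 2 * ∑ j, ‖T (M j A) - N j (T A)‖ ^ 2 + 2 * ∑ j, ‖R (N j (T A)) - N j (R (T A))‖ ^ 2 := by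
        rw [Finset.sum_add_distrib, Finset.mul_sum, Finset.mul_sum]
    _ ≤ 2 * κD ^ 2 * ‖A‖ ^ 2 + 2 * κP ^ 2 * ‖T A‖ ^ 2 := by linarith [hKD A, hKP (T A)]

/-- ★★ **THE SAME IN THE RELATIVE CURRENCY**: with `‖TA‖² ≤ ‖R(TA)‖² + c_R‖A‖²` and `‖R(TA)‖² ≤ q A + ν‖A‖²` (any functional `q`):
`Σ_j ‖R(T(M_jA)) − N_j(R(TA))‖² ≤ (2κ_D² + 2κ_P²(c_R + ν))·‖A‖² + 2κ_P²·q A`. [cite: Balaban1985BackgroundPropagators, (3.49) p.399, Thm 3.11 p.416] -/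
theorem sum_normSq_compComm_le_rel (T : E → S) (R : S →ₗ[𝕜] S) (M : J → E → E) (N : J → S → S) (q : E → ℝ) {κD κP cR ν : ℝ}
    (hR : ∀ y, ‖R y‖ ^ 2 ≤ ‖y‖ ^ 2)
    (hKD : ∀ A, ∑ j, ‖T (M j A) - N j (T A)‖ ^ 2 ≤ κD ^ 2 * ‖A‖ ^ 2)
    (hKP : ∀ y, ∑ j, ‖R (N j y) - N j (R y)‖ ^ 2 ≤ κP ^ 2 * ‖y‖ ^ 2)
    (hT : ∀ A, ‖T A‖ ^ 2 ≤ ‖R (T A)‖ ^ 2 + cR * ‖A‖ ^ 2) (hq : ∀ A, ‖R (T A)‖ ^ 2 ≤ q A + ν * ‖A‖ ^ 2) (A : E) :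
    ∑ j, ‖R (T (M j A)) - N j (R (T A))‖ ^ 2 ≤ (2 * κD ^ 2 + 2 * κP ^ 2 * (cR + ν)) * ‖A‖ ^ 2 + 2 * κP ^ 2 * q A := by
  have h := sum_normSq_compComm_le T R M N hR hKD hKP A
  have h2 : 0 ≤ 2 * κP ^ 2 := by positivity
  have h3 := mul_le_mul_of_nonneg_left (hT A) h2
  have h4 := mul_le_mul_of_nonneg_left (hq A) h2
  linarith

end Abstract

/-! ## §2 The slot at the member -/

variable {F : T3Family} {n K : ℕ} {h : n ≤ K} {c₀ cB : ℝ} [Fact (0 < c₀)] [Fact (0 < cB)]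

/-- ★★★ **SLOT `hK₂` OF ✓`curvedTarget_of_LOD_topMean` FROM ITS ROWS.**  For any background `U₀`, intertwiner `Q_U`, weight `a ≥ 0`, cut-offs `M_j` (bonds) and `N₂,j` (sites):
(K2a) `Σ_j ‖D*_{U₀}(M_jA) − N₂,j(D*_{U₀}A)‖² ≤ κ_D²‖A‖²`, (K2b) `Σ_j ‖R(N₂,j y) − N₂,j(R y)‖² ≤ κ_P²‖y‖²` (`R = projR(covLapSite U₀)Q_U`), (K2d) `‖D*A‖² ≤ ‖R(D*A)‖² + c_R‖A‖²`,
(K2e) `−ν‖A‖² ≤ re⟪A, Δ^η_{U₀}A⟫` ⟹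
`Σ_j ‖R(D*(M_jA)) − N₂,j(R(D*A))‖² ≤ (2κ_D² + 2κ_P²(c_R + ν))·‖A‖² + 2κ_P²·(re⟪A, Δ^η A⟫ + ‖R(D*A)‖² + a‖Q_kA‖²)` — the knit's `hK₂` with `κ₂² = 2κ_D² + 2κ_P²(c_R + ν)`,
`μ₂ = 2κ_P²`.  `R` is a contraction by ✓`normSq_sub_projR_eq`. [cite: Balaban1985BackgroundPropagators, (3.21) p.394, (3.49) p.399, Thm 3.11 p.416] -/
theorem hK2_of_rows (U₀ : GaugeField (F.P K) 0 (Matrix.specialUnitaryGroup (Fin 2) ℂ))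
    (QU : SiteL2K ℂ 3 (periodsT3 F K) c₀ W₂ →ₗ[ℂ] (Site (F.P K) (K - n) → Matrix (Fin 2) (Fin 2) ℂ)) {a : ℝ} (ha : 0 ≤ a)
    {J : Type*} [Fintype J]
    (M : J → BondL2K ℂ 3 (periodsT3 F K) c₀ W₂ →ₗ[ℂ] BondL2K ℂ 3 (periodsT3 F K) c₀ W₂)
    (N₂ : J → SiteL2K ℂ 3 (periodsT3 F K) c₀ W₂ → SiteL2K ℂ 3 (periodsT3 F K) c₀ W₂)
    {κD κP cR ν : ℝ}
    (hKD : ∀ A, ∑ j, ‖DstarL2 F n K c₀ U₀ (M j A) - N₂ j (DstarL2 F n K c₀ U₀ A)‖ ^ 2 ≤ κD ^ 2 * ‖A‖ ^ 2)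
    (hKP : ∀ y, ∑ j, ‖projR (covLapSite F n K c₀ U₀) QU (N₂ j y) - N₂ j (projR (covLapSite F n K c₀ U₀) QU y)‖ ^ 2 ≤ κP ^ 2 * ‖y‖ ^ 2)
    (hDst : ∀ A : BondL2K ℂ 3 (periodsT3 F K) c₀ W₂,
      ‖DstarL2 F n K c₀ U₀ A‖ ^ 2 ≤ ‖projR (covLapSite F n K c₀ U₀) QU (DstarL2 F n K c₀ U₀ A)‖ ^ 2 + cR * ‖A‖ ^ 2)
    (hν : ∀ A : BondL2K ℂ 3 (periodsT3 F K) c₀ W₂, -(ν * ‖A‖ ^ 2) ≤ RCLike.re ⟪A, DeltaEta F n K c₀ U₀ A⟫_ℂ) :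
    ∀ A : BondL2K ℂ 3 (periodsT3 F K) c₀ W₂,
      ∑ j, ‖projR (covLapSite F n K c₀ U₀) QU (DstarL2 F n K c₀ U₀ (M j A)) - N₂ j (projR (covLapSite F n K c₀ U₀) QU (DstarL2 F n K c₀ U₀ A))‖ ^ 2
        ≤ (2 * κD ^ 2 + 2 * κP ^ 2 * (cR + ν)) * ‖A‖ ^ 2
          + 2 * κP ^ 2 * (RCLike.re ⟪A, DeltaEta F n K c₀ U₀ A⟫_ℂ + ‖projR (covLapSite F n K c₀ U₀) QU (DstarL2 F n K c₀ U₀ A)‖ ^ 2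
            + a * ‖Qk F n K h c₀ cB U₀ A‖ ^ 2) := by
  intro A
  have hR : ∀ y : SiteL2K ℂ 3 (periodsT3 F K) c₀ W₂, ‖projR (covLapSite F n K c₀ U₀) QU y‖ ^ 2 ≤ ‖y‖ ^ 2 := fun y => by
    have e := normSq_sub_projR_eq (covLapSite F n K c₀ U₀) QU y
    nlinarith [sq_nonneg ‖y - projR (covLapSite F n K c₀ U₀) QU y‖]
  have hq : ∀ B : BondL2K ℂ 3 (periodsT3 F K) c₀ W₂,
      ‖projR (covLapSite F n K c₀ U₀) QU (DstarL2 F n K c₀ U₀ B)‖ ^ 2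
        ≤ (RCLike.re ⟪B, DeltaEta F n K c₀ U₀ B⟫_ℂ + ‖projR (covLapSite F n K c₀ U₀) QU (DstarL2 F n K c₀ U₀ B)‖ ^ 2 + a * ‖Qk F n K h c₀ cB U₀ B‖ ^ 2)
          + ν * ‖B‖ ^ 2 := fun B => by
    have h1 := hν B
    have h2 : 0 ≤ a * ‖Qk F n K h c₀ cB U₀ B‖ ^ 2 := by positivity
    linarith
  exact sum_normSq_compComm_le_rel (fun B => DstarL2 F n K c₀ U₀ B) (projR (covLapSite F n K c₀ U₀) QU) (fun j B => M j B) N₂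
    (fun B => RCLike.re ⟪B, DeltaEta F n K c₀ U₀ B⟫_ℂ + ‖projR (covLapSite F n K c₀ U₀) QU (DstarL2 F n K c₀ U₀ B)‖ ^ 2 + a * ‖Qk F n K h c₀ cB U₀ B‖ ^ 2)
    hR hKD hKP hDst hq A

end Summit.QuantumFields.YangMills.Theorems.Prop7LODSlotK2

end
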